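import Summits.QuantumFields.YangMills.Theorems.BalabanUVNodesN06CutLettersPinsPrintAtRecord
import Literature.MathematicalPhysics.QuantumFieldTheory.Balaban1983to89.B9RWSums347DefiniteFaces
import Literature.MathematicalPhysics.QuantumFieldTheory.Balaban1983to89.B9Thm313WholeRgdFrom3152
import Literature.MathematicalPhysics.QuantumFieldTheory.Balaban1983to89.B9RowSum261DefiniteFaces
import Literature.MathematicalPhysics.QuantumFieldTheory.Balaban1983to89.B9PerturbationMajorantsAtLettersPhys
import Literature.MathematicalPhysics.QuantumFieldTheory.Balaban1983to89.B9GradViaDivLettersTransported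
import Literature.MathematicalPhysics.QuantumFieldTheory.Balaban1983to89.B9BackgroundsKLevelV1R
import Literature.MathematicalPhysics.QuantumFieldTheory.Balaban1983to89.B9GeoLemma21KLevelV1
import Literature.MathematicalPhysics.QuantumFieldTheory.Balaban1983to89.B9PinMembersKLevelV1
import Literature.MathematicalPhysics.QuantumFieldTheory.Balaban1983to89.B9LettersHZAtOne
import Literature.MathematicalPhysics.QuantumFieldTheory.Balaban1983to89.B9CoReadingCoordsHolderAdm

/-!
# BalabanUVNodes ∕ N06 ([B9], `Dag.B9_main`) — ROWS 20–21's LETTER `rgd2` (R∇\*_UG₁ : 𝔠⁽⁰⁾ → 𝔠_W⁽¹⁾, the 4th conjunct of the certificate's display `hZ8`) DERIVED ABOVE A CLOSED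
# THRESHOLD AT THE PINS from THE PRINTED IDENTITY (3.152) `R∇\*_UG₁ = RG′∇\*_U`, Theorem 3.1 (`h31`) and (3.49) (`h49`) — dag-n06-l g16's landed `B9Thm313WholeRgdFrom3152.rgd2_of_ids3152`
# read at the members; display economy `hZ8 ↦ hZ7` for the rows face `…Thm312313AtPinsStateSUZ7` (NOT a flag item: `rgd2` is a G₁-letter of printed species, not a raw-class step)

Track A of `YM-PLAN.md` (cell `pub-ymgap`, HUMAN RULING D-0062), node **N06** = [Balaban1985BackgroundPropagators] Thms 3.1–3.15; seat `pub-ymgap-dag-n06-l` (gen 29)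
for the `pub-ymgap-dag-n06-d` knit (programme P-DISP, first item).  WHY.  The certificate of record displays the eight bXH-free Z-letters of Theorem 3.13's reduction as
ONE 8-conjunction `hZ8`; its 4th conjunct `rgd2 : HasMaj 𝔠⁽⁰⁾ 𝔠_W⁽¹⁾ (R ∘ ∇\*_U ∘ G₁ ∘ id) (B₃·e^{−δ₃ d})` is a Theorem-3.12-type statement about the PERTURBED propagator G₁ —
GAP-STATED as displayed, although print never estimates R∇\*_UG₁ directly: p. 426 *«(3.151) gives RD\*G₁ = RG′D\*»* ((3.152)), i.e. Theorem 3.1's member G′∇\*_U followed by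
R = c_R⁻¹(I − P) with (3.49).  dag-n06-l g16 typed exactly this reduction (`rgd2_of_ids3152`, 2026-08-28; «the knit decides») — never wired.  THIS FILE wires it at the members:
★★ `hrgd2_of_pinsP_geo9Y : ∃ M, ∀ x, M ≤ (geo9Y x).M → ∀ α₀>0, Mα₀ ≤ a₀ → ∀ U, Reg335 → Reg336 → Ids3152 (𝔬12 x) (GcoS … (GpY …)) U → HasMaj (cNorm 1 (H x) (𝔬12 x).blk _ 0)
(cNorm 1 (H x) (𝔬12 x).blkW _ 1) (R ∘ ∇\*_U ∘ G₁ ∘ id) (B₃·e^{−δ₃ d})` from Theorem 3.1 `h31 : Thm31GpMaj … B₀ δ₀`, (3.49) `h49 : Proj349Maj … CP δP`, `R = c_R⁻¹(I − P)` (`hRco12`,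
`rcoK_GpPhysY`), the member facts `Facts347` at the displayed `(αW, δFW)` and `RowSum` at `σW` DISCHARGED (`facts347_exp261_geo9Y`, `rowConst261_spec_of_rowSum261 rowSum261_geo9Y`),
the budget `hbud ∕ hδ₃w` of the `wGp` leg VERBATIM (`0 ≤ δFW − αW·δFW − 2σW`, `δ₃ ≤ …`) and ONE numeric `hB₃r : constA c_R⁻¹ B₀ C_P (rowConst261 σW) (ℓ+1) ≤ B₃`
(`constA ϱ B₀ C_P c L = ϱB₀(1 + L²C_Pc)`, monotone in `L ≤ ℓ+1` by `geo9Y_scalars`); the identity `Ids3152 …` is taken member-wise AFTER the threshold exactly as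
`…N06RgdH43LegAtPinsPhysPU.hrgdH_of_pinsP43_geo9Y` takes it (the certificate's derived `h152`).
HONEST FRAMING.  Kernel bookkeeping (∃-packaging of one landed Literature theorem with landed member-fact theorems); `h31`, `h49` are HYPOTHESES of printed species
(Thm 3.1 ∕ (3.49)), (3.152) enters BY NAME; nothing of [B9] asserted; COUNT-NEUTRAL; N06 NOT discharged; K1⁹ NOT closed; one finite 𝕋⁴ programme at fixed `ε` —
NOT continuum ∕ OS ∕ mass gap ∕ Clay.  0 `def`, 0 `sorry`.
-/

noncomputable section

namespace Summit.QuantumFields.YangMills.BalabanUVNodes.N06Rgd2LegAtPinsPhysPU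

open Literature.MathematicalPhysics.QuantumFieldTheory.Balaban1983to89
open Literature.MathematicalPhysics.QuantumFieldTheory.Balaban1983to89.Node00 (FBondY IBondY SiteY CfgY SiteParY SiteOpY BondParY parSymY parBY GpY GpPhysY)
open Literature.MathematicalPhysics.QuantumFieldTheory.Balaban1983to89.Node00.OpsYSectDCoords (DvcoKH DvscoKH RcoK cR39_trBasis_pos)
open Literature.MathematicalPhysics.QuantumFieldTheory.Balaban1983to89.B9Thm39ReadingCoords (cR39)
open Literature.MathematicalPhysics.QuantumFieldTheory.Balaban1983to89.B9Thm34Ext (toB6)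
open Literature.MathematicalPhysics.QuantumFieldTheory.Balaban1983to89.B11SectG (HasMaj BlockNorm RowSum)
open Literature.MathematicalPhysics.QuantumFieldTheory.Balaban1983to89.B9Thm312Whole (cNorm GeoOK)
open Literature.MathematicalPhysics.QuantumFieldTheory.Balaban1983to89.B9Thm312WholeClasses (cNormR)
open Literature.MathematicalPhysics.QuantumFieldTheory.Balaban1983to89.B9RWSums343Holder (HolderProbes)
open Literature.MathematicalPhysics.QuantumFieldTheory.Balaban1983to89.B9RWSums343to347Whole (Facts347)
open Literature.MathematicalPhysics.QuantumFieldTheory.Balaban1983to89.B9CoReadingCoords (XBK blkBK)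
open Literature.MathematicalPhysics.QuantumFieldTheory.Balaban1983to89.B9CoReadingCoordsS (XSK sIK blkSK GcoS)
open Literature.MathematicalPhysics.QuantumFieldTheory.Balaban1983to89.B9CoReadingCoordsH (XHK)
open Literature.MathematicalPhysics.QuantumFieldTheory.Balaban1983to89.B9CoReadingCoordsHolder (PK)
open Literature.MathematicalPhysics.QuantumFieldTheory.Balaban1983to89.B9CoReadingCoordsTranspose (TrIdx trBasis)
open Literature.MathematicalPhysics.QuantumFieldTheory.Balaban1983to89.B9PinMembersKLevelV1 (MemberY geo9Y)
open Literature.MathematicalPhysics.QuantumFieldTheory.Balaban1983to89.B9BackgroundsKLevelV1R (RegFamY bg9YR MemOfFam)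
open Literature.MathematicalPhysics.QuantumFieldTheory.Balaban1983to89.B9GeoLemma21KLevelV1 (geo9Y_len_pos geo9Y_dist_triangle geo9Y_dist_comm)
open Literature.MathematicalPhysics.QuantumFieldTheory.Balaban1983to89.B9GeoNormsKLevelV1 (geo9K geo9K_dist_nonneg)
open Literature.MathematicalPhysics.QuantumFieldTheory.Balaban1983to89.B7Prop2SpecialUnitary (specialUnitaryUnits)
open Literature.MathematicalPhysics.QuantumFieldTheory.Balaban1983to89.B9PerturbationMajorantAlgebra (Proj349Maj)
open Literature.MathematicalPhysics.QuantumFieldTheory.Balaban1983to89.B9PerturbationMajorantsAtLetters (PcoK rcoK_eq)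
open Literature.MathematicalPhysics.QuantumFieldTheory.Balaban1983to89.B9PerturbationMajorantsAtLettersPhys (rcoK_GpPhysY)
open Literature.MathematicalPhysics.QuantumFieldTheory.Balaban1983to89.B9MultiscaleSmoothPartitionYNear (rNear)
open Literature.MathematicalPhysics.QuantumFieldTheory.Balaban1983to89.B9SmoothHolderClassP (bHZKP bHZKPG)
open Literature.MathematicalPhysics.QuantumFieldTheory.Balaban1983to89.B9GradViaDivLettersTransported (taxiB)
open Literature.MathematicalPhysics.QuantumFieldTheory.Balaban1983to89.B9Thm313WholeCutLettersAtPinsP (wGp_bHZKPG_of_pins)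
open Literature.MathematicalPhysics.QuantumFieldTheory.Balaban1983to89.B9RWSums347DefiniteFaces (exp261 facts347_exp261_geo9Y geo9Y_scalars)
open Literature.MathematicalPhysics.QuantumFieldTheory.Balaban1983to89.B9RowSum261DefiniteFaces (rowConst261 rowConst261_nonneg rowConst261_spec_of_rowSum261)
open Literature.MathematicalPhysics.QuantumFieldTheory.Balaban1983to89.B9GeoLemma21KLevelV1 (rowSum261_geo9Y)
open Literature.MathematicalPhysics.QuantumFieldTheory.Balaban1983to89.B9SectDSup (weightNorm)
open Literature.MathematicalPhysics.QuantumFieldTheory.Balaban1983to89.B6RandomWalkHom (HasMajorantHom)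
open Literature.MathematicalPhysics.QuantumFieldTheory.Balaban1983to89.B9Thm313WholeLettersCut (Letters313Zc)
open Literature.MathematicalPhysics.QuantumFieldTheory.Balaban1983to89.B9PerturbationMajorantAlgebra (Thm31GpMaj constA)
open Literature.MathematicalPhysics.QuantumFieldTheory.Balaban1983to89.B9Thm313WholeRgdFrom3152 (Ids3152 rgd2_of_ids3152)
open Literature.MathematicalPhysics.QuantumFieldTheory.Balaban1983to89.B9Thm312Whole (Identities)
open Literature.MathematicalPhysics.QuantumFieldTheory.Balaban1983to89.B9CoReadingCoordsHolder (blkPK probeK wK w₀K)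
open Literature.MathematicalPhysics.QuantumFieldTheory.Balaban1983to89.B9CoReadingCoordsHolderAdm (wKA holderProbesKA)
open Literature.MathematicalPhysics.QuantumFieldTheory.Balaban1983to89.B9LettersHZAtOne (plateau_pos)
open B6GlobalChartV1 (PV blkV1) open B6Ineq2142KLevelV1 (β lvl) open B6Geom246MultiLevelTorus (geomT)
open scoped Matrix.Norms.L2Operator

variable {N : ℕ} {d ℓ : ℕ} {hd : 1 ≤ d + 1} {hL : Odd (ℓ + 1) ∧ 1 < ℓ + 1} {b₀ b₁ : ℝ} {Mstar : ℕ}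

/-- ★★ **`rgd2` (R∇\*_UG₁ : 𝔠⁽⁰⁾ → 𝔠_W⁽¹⁾) DERIVED ABOVE A CLOSED THRESHOLD AT THE PINS BY (3.152)** (module docstring): from Theorem 3.1 `h31`, (3.49) `h49`,
`R = c_R⁻¹(I − P)`, the budget `hbud ∕ hδ₃w ∕ hB₃r` on the displayed `αW σW δFW` and the member-wise identity `Ids3152 …`, there is a threshold `M` above which the letter holds
at `(B₃, δ₃)` for every member — dag-n06-l g16's `rgd2_of_ids3152`, member facts discharged. [cite: Balaban1985BackgroundPropagators, (3.152)–(3.153) p.426 + Thm 3.1 (3.42) p.397 + (3.49) p.399 + Thm 3.13 p.426; Balaban1984PropagatorsII, (2.52)–(2.56) pp.232–233 + Lemma 2.1 (2.60)–(2.61) p.234] -/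
theorem hrgd2_of_pinsP_geo9Y [NeZero N] [∀ x : MemberY d ℓ hd hL b₀ b₁ Mstar, Fintype (geo9Y x).Site]
    {R₁ R₂ : RegFamY d ℓ hd hL b₀ b₁ Mstar (Matrix (Fin N) (Fin N) ℂ)} (H : MemberY d ℓ hd hL b₀ b₁ Mstar → Prop)
    (bI : ∀ x : MemberY d ℓ hd hL b₀ b₁ Mstar, FBondY x.toKIdx → IBondY x.toKIdx)
    (c : ℝ) {M₀ a₀ : ℝ} {αW σW δFW : ℝ} (hαW0 : 0 < αW) (hαW1 : αW < 1) (hσW : 0 < σW) (hδFW : 0 < δFW)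
    (𝔬12 : ∀ x : MemberY d ℓ hd hL b₀ b₁ Mstar, B9Thm312Whole.Ops (geo9Y x) (bg9YR (Matrix (Fin N) (Fin N) ℂ) (specialUnitaryUnits (Fin N)) R₁ R₂ x) (XBK (TrIdx N) x.toKIdx) (XBK (TrIdx N) x.toKIdx) (XHK (TrIdx N) x.toKIdx) (XSK (TrIdx N) x.toKIdx))
    (hblk12 : ∀ x : MemberY d ℓ hd hL b₀ b₁ Mstar, (𝔬12 x).blk = blkBK x.toKIdx (bI x))
    (hblkW12 : ∀ x : MemberY d ℓ hd hL b₀ b₁ Mstar, (𝔬12 x).blkW = blkSK x.toKIdx (sIK x.toKIdx (bI x)))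
    (hDvco12 : ∀ (x : MemberY d ℓ hd hL b₀ b₁ Mstar) (U : (bg9YR (Matrix (Fin N) (Fin N) ℂ) (specialUnitaryUnits (Fin N)) R₁ R₂ x).Cfg), (𝔬12 x).Dv U = DvcoKH x.toKIdx (trBasis N) (bg9YR (Matrix (Fin N) (Fin N) ℂ) (specialUnitaryUnits (Fin N)) R₁ R₂ x) (fun U => U) U)
    (hDvsco12 : ∀ (x : MemberY d ℓ hd hL b₀ b₁ Mstar) (U : (bg9YR (Matrix (Fin N) (Fin N) ℂ) (specialUnitaryUnits (Fin N)) R₁ R₂ x).Cfg), (𝔬12 x).Dvstar U = DvscoKH x.toKIdx (trBasis N) (bg9YR (Matrix (Fin N) (Fin N) ℂ) (specialUnitaryUnits (Fin N)) R₁ R₂ x) (fun U => U) U)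
    (hRco12 : ∀ (x : MemberY d ℓ hd hL b₀ b₁ Mstar) (U : (bg9YR (Matrix (Fin N) (Fin N) ℂ) (specialUnitaryUnits (Fin N)) R₁ R₂ x).Cfg), (𝔬12 x).R U = RcoK x.toKIdx (trBasis N) (bg9YR (Matrix (Fin N) (Fin N) ℂ) (specialUnitaryUnits (Fin N)) R₁ R₂ x) (fun U => U) (parSymY x.toKIdx) (GpPhysY x.toKIdx (parSymY x.toKIdx)) U)
    {B₃ δ₃ : ℝ}
    {B₀ δ₀ CP δP : ℝ} (hB₀ : 0 ≤ B₀) (hCP : 0 ≤ CP)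
    (hδ₀ : δFW ≤ δ₀) (hδP : δFW ≤ δP) (hbud : 0 ≤ δFW - αW * δFW - 2 * σW)
    (hB₃r : constA (cR39 (trBasis N))⁻¹ B₀ CP (rowConst261 (@geo9Y d ℓ hd hL b₀ b₁ Mstar) σW) (((ℓ + 1 : ℕ) : ℝ)) ≤ B₃) (hδ₃w : δ₃ ≤ δFW - αW * δFW - 2 * σW)
    {parS : ∀ x : MemberY d ℓ hd hL b₀ b₁ Mstar, SiteParY (Matrix (Fin N) (Fin N) ℂ) x.toKIdx} {Gp : ∀ x : MemberY d ℓ hd hL b₀ b₁ Mstar, SiteOpY (Matrix (Fin N) (Fin N) ℂ) x.toKIdx}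
    (hparS : ∀ x : MemberY d ℓ hd hL b₀ b₁ Mstar, parS x = parSymY x.toKIdx) (hGp : ∀ x : MemberY d ℓ hd hL b₀ b₁ Mstar, Gp x = GpY x.toKIdx (parSymY x.toKIdx))
    (h31 : ∀ x : MemberY d ℓ hd hL b₀ b₁ Mstar, M₀ ≤ (geo9Y x).M → ∀ α₀ : ℝ, 0 < α₀ → (geo9Y x).M * α₀ ≤ a₀ → ∀ U : (bg9YR (Matrix (Fin N) (Fin N) ℂ) (specialUnitaryUnits (Fin N)) R₁ R₂ x).Cfg, (bg9YR (Matrix (Fin N) (Fin N) ℂ) (specialUnitaryUnits (Fin N)) R₁ R₂ x).Reg335 c α₀ U →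
      Thm31GpMaj (g := geo9Y x) (blkSK x.toKIdx (sIK x.toKIdx (bI x))) (blkBK x.toKIdx (bI x))
        (GcoS x.toKIdx (trBasis N) (bg9YR (Matrix (Fin N) (Fin N) ℂ) (specialUnitaryUnits (Fin N)) R₁ R₂ x) (fun U => U) (Gp x) U)
        (DvcoKH x.toKIdx (trBasis N) (bg9YR (Matrix (Fin N) (Fin N) ℂ) (specialUnitaryUnits (Fin N)) R₁ R₂ x) (fun U => U) U) (DvscoKH x.toKIdx (trBasis N) (bg9YR (Matrix (Fin N) (Fin N) ℂ) (specialUnitaryUnits (Fin N)) R₁ R₂ x) (fun U => U) U) 1 (H x) B₀ δ₀)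
    (h49 : ∀ x : MemberY d ℓ hd hL b₀ b₁ Mstar, M₀ ≤ (geo9Y x).M → ∀ α₀ : ℝ, 0 < α₀ → (geo9Y x).M * α₀ ≤ a₀ → ∀ U : (bg9YR (Matrix (Fin N) (Fin N) ℂ) (specialUnitaryUnits (Fin N)) R₁ R₂ x).Cfg, (bg9YR (Matrix (Fin N) (Fin N) ℂ) (specialUnitaryUnits (Fin N)) R₁ R₂ x).Reg335 c α₀ U →
      Proj349Maj (g := geo9Y x) (blkSK x.toKIdx (sIK x.toKIdx (bI x))) (blkBK x.toKIdx (bI x))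
        (PcoK x.toKIdx (trBasis N) (bg9YR (Matrix (Fin N) (Fin N) ℂ) (specialUnitaryUnits (Fin N)) R₁ R₂ x) (fun U => U) (parS x) (Gp x) U)
        (DvcoKH x.toKIdx (trBasis N) (bg9YR (Matrix (Fin N) (Fin N) ℂ) (specialUnitaryUnits (Fin N)) R₁ R₂ x) (fun U => U) U) (DvscoKH x.toKIdx (trBasis N) (bg9YR (Matrix (Fin N) (Fin N) ℂ) (specialUnitaryUnits (Fin N)) R₁ R₂ x) (fun U => U) U) 1 (H x) CP δP) :
    ∃ M13 : ℝ, ∀ x : MemberY d ℓ hd hL b₀ b₁ Mstar, letI : Fintype (geo9K x.toKIdx).Site := (inferInstance : Fintype (geo9Y x).Site); M13 ≤ (geo9Y x).M → ∀ α₀ : ℝ, 0 < α₀ → (geo9Y x).M * α₀ ≤ a₀ → ∀ U : (bg9YR (Matrix (Fin N) (Fin N) ℂ) (specialUnitaryUnits (Fin N)) R₁ R₂ x).Cfg, (bg9YR (Matrix (Fin N) (Fin N) ℂ) (specialUnitaryUnits (Fin N)) R₁ R₂ x).Reg335 c α₀ U →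
      (bg9YR (Matrix (Fin N) (Fin N) ℂ) (specialUnitaryUnits (Fin N)) R₁ R₂ x).Reg336 c α₀ U → Ids3152 (𝔬12 x) (GcoS x.toKIdx (trBasis N) (bg9YR (Matrix (Fin N) (Fin N) ℂ) (specialUnitaryUnits (Fin N)) R₁ R₂ x) (fun U => U) (GpY x.toKIdx (parSymY x.toKIdx))) U →
        HasMaj (cNorm 1 (H x) (𝔬12 x).blk (fun y => (geo9Y_len_pos x y).le) 0) (cNorm 1 (H x) (𝔬12 x).blkW (fun y => (geo9Y_len_pos x y).le) 1)
          ((𝔬12 x).R U ∘ₗ (𝔬12 x).Dvstar U ∘ₗ (𝔬12 x).G1 U ∘ₗ LinearMap.id) (fun a b => B₃ * Real.exp (-(δ₃ * (geo9Y x).dist a b))) := by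
  obtain ⟨Mg, hFa⟩ := facts347_exp261_geo9Y (d := d) (ℓ := ℓ) (hd := hd) (hL := hL) (b₀ := b₀) (b₁ := b₁) (Mstar := Mstar) H hαW0 hαW1 hδFW
  obtain ⟨ML, hrow⟩ := rowConst261_spec_of_rowSum261 (rowSum261_geo9Y (d := d) (ℓ := ℓ) (hd := hd) (hL := hL) (b₀ := b₀) (b₁ := b₁) (Mstar := Mstar)) hσW
  have hc0 : (0 : ℝ) ≤ rowConst261 (@geo9Y d ℓ hd hL b₀ b₁ Mstar) σW := rowConst261_nonneg _ _
  have hαδ : 0 ≤ αW * δFW := (mul_pos hαW0 hδFW).le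
  refine ⟨max M₀ (max Mg ML), fun x hM α₀ hα ha U hU hU' h152x => ?_⟩
  letI : Fintype (geo9K x.toKIdx).Site := (inferInstance : Fintype (geo9Y x).Site)
  have hM0 : M₀ ≤ (geo9Y x).M := (le_max_left _ _).trans hM
  have hrowx : RowSum (toB6 (geo9Y x) 1 (H x)) σW (rowConst261 (@geo9Y d ℓ hd hL b₀ b₁ Mstar) σW) := fun y => hrow x (((le_max_right _ _).trans (le_max_right _ _)).trans hM) y
  have hFax := hFa x (((le_max_left _ _).trans (le_max_right _ _)).trans hM)
  have hG : GeoOK (geo9Y x) := ⟨geo9Y_dist_triangle x, geo9Y_dist_comm x, geo9K_dist_nonneg x.toKIdx, geo9Y_len_pos x⟩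
  have hN : 0 < N := Nat.pos_of_ne_zero (NeZero.ne N)
  have hϱ : 0 ≤ (cR39 (trBasis N))⁻¹ := inv_nonneg.2 (cR39_trBasis_pos hN).le
  have hR : (𝔬12 x).R U = (cR39 (trBasis N))⁻¹ • (LinearMap.id -
      PcoK x.toKIdx (trBasis N) (bg9YR (Matrix (Fin N) (Fin N) ℂ) (specialUnitaryUnits (Fin N)) R₁ R₂ x) (fun U => U) (parSymY x.toKIdx) (GpY x.toKIdx (parSymY x.toKIdx)) U) := by
    rw [hRco12 x U, rcoK_GpPhysY, rcoK_eq]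
  have h49' : Proj349Maj (𝔬12 x).blkW (𝔬12 x).blk
      (PcoK x.toKIdx (trBasis N) (bg9YR (Matrix (Fin N) (Fin N) ℂ) (specialUnitaryUnits (Fin N)) R₁ R₂ x) (fun U => U) (parSymY x.toKIdx) (GpY x.toKIdx (parSymY x.toKIdx)) U)
      ((𝔬12 x).Dv U) ((𝔬12 x).Dvstar U) 1 (H x) CP δP := by
    rw [hblkW12 x, hblk12 x, hDvco12 x U, hDvsco12 x U, ← hGp x, ← hparS x]
    exact h49 x hM0 α₀ hα ha U hU
  have h31' : Thm31GpMaj (𝔬12 x).blkW (𝔬12 x).blk (GcoS x.toKIdx (trBasis N) (bg9YR (Matrix (Fin N) (Fin N) ℂ) (specialUnitaryUnits (Fin N)) R₁ R₂ x) (fun U => U) (GpY x.toKIdx (parSymY x.toKIdx)) U) ((𝔬12 x).Dv U) ((𝔬12 x).Dvstar U) 1 (H x) B₀ δ₀ := by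
    rw [hblkW12 x, hblk12 x, hDvco12 x U, hDvsco12 x U, ← hGp x]
    exact h31 x hM0 α₀ hα ha U hU
  -- `rgd2 = R∘G′∘D*` by the printed identity (3.152), Theorem 3.1 (`h31`) and (3.49) (`h49`): dag-n06-l g16 `rgd2_of_ids3152`, the member's `L ≤ ℓ+1` moved into `constA`
  have hLx : (geo9Y x).L ≤ (((ℓ + 1 : ℕ) : ℝ)) := (geo9Y_scalars x).2.1
  have hL0 : 0 ≤ (geo9Y x).L := le_trans zero_le_one hFax.one_le_L
  have hmono : constA (cR39 (trBasis N))⁻¹ B₀ CP (rowConst261 (@geo9Y d ℓ hd hL b₀ b₁ Mstar) σW) (geo9Y x).L ≤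
      constA (cR39 (trBasis N))⁻¹ B₀ CP (rowConst261 (@geo9Y d ℓ hd hL b₀ b₁ Mstar) σW) (((ℓ + 1 : ℕ) : ℝ)) := by
    unfold constA
    have h2 : (geo9Y x).L ^ 2 ≤ (((ℓ + 1 : ℕ) : ℝ)) ^ 2 := pow_le_pow_left₀ hL0 hLx 2
    have h3 : (geo9Y x).L ^ 2 * CP * rowConst261 (@geo9Y d ℓ hd hL b₀ b₁ Mstar) σW ≤ (((ℓ + 1 : ℕ) : ℝ)) ^ 2 * CP * rowConst261 (@geo9Y d ℓ hd hL b₀ b₁ Mstar) σW :=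
      mul_le_mul_of_nonneg_right (mul_le_mul_of_nonneg_right h2 hCP) hc0
    exact mul_le_mul_of_nonneg_left (by linarith) (mul_nonneg hϱ hB₀)
  exact rgd2_of_ids3152 hG hFax hrowx h31' h49' hR h152x hϱ hB₀ hCP hc0 hσW.le hαδ hδ₀ hδP (by linarith [hσW.le]) (hmono.trans hB₃r) (by linarith [hσW.le])

end Summit.QuantumFields.YangMills.BalabanUVNodes.N06Rgd2LegAtPinsPhysPU

end
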